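import Summits.BirchSwinnertonDyer.Rank1Residual.ManinAdditive.ConwayCut
import Summits.BirchSwinnertonDyer.Rank1Residual.ManinAdditive.RamanujanCut
import HarnessLib

/-!
# Edges for the Conway cut at `2` and the Ramanujan cut at `3` (desc g5): refuter-1's kernel items RB61.1–RB61.4

PROVED lemmas only (no definition, no conjecture), copied VERBATIM from refuter-1's audit kernel
HOME/ref1-C61-desc-g5-audit.lean sha16 **b4de42f85e3d09e2** (`section RefAudit61`, farm rc 0 · 0/0/0, axioms
`propext, Classical.choice, Quot.sound`; report HOME/ref1/R53-ref1-desc-g5.md c6742c70ee41a6e6, §R53 of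
`bsd-f2-manin` REFUTER-ref1.md), namespace `DescG5` ↦ the two leaf namespaces `…ManinAdditive.ConwayCut` /
`…ManinAdditive.RamanujanCut` (both opened), per-declaration docstrings added:

* RB61.1 — `S^G` and `S^R` are MAXIMA, not just suprema (the `sSup` is itself stable) and contain every stable
  integral lattice: `le_conwayStableLattice_of_stable`, `conwayStableLattice_map_atkinLehner_le`,
  `conwayStableLattice_map_halfTranslate_le`, `le_ramanujanStableLattice_of_stable`,
  `ramanujanStableLattice_map_ramanujanThree_le`;
* RB61.2 — the newform line lies INSIDE `S^G` / `S^R` given the `±1`-eigen hypotheses (`4 ∣ N`: `t f = −f`;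
  `9 ∣ N`: `R₃ f = −f`; `w_{Q_p} f = ±f` is the tree fact `IsNewform0.exists_atkinLehnerInvolutionAt_eq_smul`,
  Knapp Thm. 9.27 (b)): `span_le_conwayStableLattice`, `span_le_ramanujanStableLattice` — so the `lineIndex` in
  rows E-desc-31/32/35/36 is a genuine finite `f`-line index in scope, not the junk `0`;
* RB61.3 — the GIVEN predicates have teeth: `not_isConwayNeronAtTwo_of_Λ_eq_bot`,
  `not_isRamanujanNeronAtThree_of_Λ_eq_bot`;
* RB61.4 — the E-facing shadow of E-desc-35: `three_dvd_modularDegree_of_threeStarDefectLaw`.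
NOT landed: the 2-adic shadows `two_dvd_modularDegree_of_conwayDefectOfIrreducible` /
`two_dvd_modularDegree_of_tameConwayTorsionLaw` and RB61.5 `tameConwayTorsionLaw_of_defect_of_full` — they concern
rows E-desc-29/30, which are not filed (falsified in-engine by desc g6 at 92a1; see `ConwayCut`).
Cell `bsd-f2-manin` (D-0131 (3)); bears_on stmt-BirchSwinnertonDyer-22967 (2-adic) / 22968 (3-adic). Nothing here
proves a summit statement; BSD is not proved by this; Manin's conjecture is not proved by this.
-/

noncomputable section

open scoped MatrixGroups ModularForm

open CongruenceSubgroup WeierstrassCurve Literature.NumberTheory.EllipticCurves.ModularForms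
  Literature.NumberTheory.DiophantineGeometry

namespace Summit.BirchSwinnertonDyer.Rank1Residual.ManinAdditive

open ConwayCut RamanujanCut


open scoped Classical

/-! ### RB61.1  `S^G` and `S^R` are MAXIMA, not just suprema (the `sSup` is itself stable), and contain every
stable integral lattice — so «largest stable sublattice» in the docstrings is literally what is typed. -/

/-- Every `⟨w_Q, t⟩`-stable integral lattice lies in `S^G` (it IS the `sSup`). (refuter-1 RB61.1, VERBATIM.) -/
theorem le_conwayStableLattice_of_stable {N : ℕ} [NeZero N] {M : Submodule ℤ (CuspForm (Gamma0 N) 2)}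
    (hM : M ≤ integralCuspForms0 N 2)
    (hw : ∀ p : ℕ, p.Prime → p ∣ N → M.map ((atkinLehnerInvolutionAt N 2 p).restrictScalars ℤ) ≤ M)
    (ht : M.map ((halfTranslate N 2).restrictScalars ℤ) ≤ M) :
    M ≤ conwayStableLattice N :=
  le_sSup ⟨hM, hw, ht⟩

/-- `S^G` is itself `w_{Q_p}`-stable: the `sSup` is a MAX. (refuter-1 RB61.1, VERBATIM.) -/
theorem conwayStableLattice_map_atkinLehner_le {N : ℕ} [NeZero N] (p : ℕ) (hp : p.Prime) (hpN : p ∣ N) :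
    (conwayStableLattice N).map ((atkinLehnerInvolutionAt N 2 p).restrictScalars ℤ) ≤ conwayStableLattice N := by
  rw [Submodule.map_le_iff_le_comap]
  exact sSup_le fun M hM => Submodule.map_le_iff_le_comap.mp ((hM.2.1 p hp hpN).trans (le_sSup hM))

/-- `S^G` is itself `t`-stable. (refuter-1 RB61.1, VERBATIM.) -/
theorem conwayStableLattice_map_halfTranslate_le {N : ℕ} [NeZero N] :
    (conwayStableLattice N).map ((halfTranslate N 2).restrictScalars ℤ) ≤ conwayStableLattice N := by
  rw [Submodule.map_le_iff_le_comap]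
  exact sSup_le fun M hM => Submodule.map_le_iff_le_comap.mp (hM.2.2.trans (le_sSup hM))

/-- Every `⟨w_Q, R₃⟩`-stable integral lattice lies in `S^R`. (refuter-1 RB61.1, VERBATIM.) -/
theorem le_ramanujanStableLattice_of_stable {N : ℕ} [NeZero N] {M : Submodule ℤ (CuspForm (Gamma0 N) 2)}
    (hM : M ≤ integralCuspForms0 N 2)
    (hw : ∀ p : ℕ, p.Prime → p ∣ N → M.map ((atkinLehnerInvolutionAt N 2 p).restrictScalars ℤ) ≤ M)
    (hR : M.map ((ramanujanThree N 2).restrictScalars ℤ) ≤ M) :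
    M ≤ ramanujanStableLattice N :=
  le_sSup ⟨hM, hw, hR⟩

/-- `S^R` is itself `R₃`-stable. (refuter-1 RB61.1, VERBATIM.) -/
theorem ramanujanStableLattice_map_ramanujanThree_le {N : ℕ} [NeZero N] :
    (ramanujanStableLattice N).map ((ramanujanThree N 2).restrictScalars ℤ) ≤ ramanujanStableLattice N := by
  rw [Submodule.map_le_iff_le_comap]
  exact sSup_le fun M hM => Submodule.map_le_iff_le_comap.mp (hM.2.2.trans (le_sSup hM))

/-! ### RB61.2  The newform line lies INSIDE `S^G` / `S^R` as soon as `f` is a `t`- (resp. `R₃`-) eigenvector with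
eigenvalue `±1` — which is the case at `4 ∣ N` (`a₂ = 0 ⇒ a_{2m} = 0 ⇒ t f = −f`) resp. `9 ∣ N` (`a₃ = 0 ⇒ R₃ f = −f`);
so `lineIndex (conwayStableLattice N) D.f` is a genuine finite `f`-line index there, not the junk `0`.  The
eigen-hypotheses are passed explicitly (they are `q`-expansion facts the tree does not yet prove). -/

/-- `ℤ∙f ≤ S^G` for an integral `f` that is a `±1`-eigenvector of every `w_{Q_p}` and of `t` (at `4 ∣ N`: `a₂ = 0 ⇒ t f = −f`; Knapp Thm. 9.27 (b) for `w_Q`), so `lineIndex (conwayStableLattice N) f` is a genuine finite index there. (refuter-1 RB61.2, VERBATIM.) [cite: Knapp1992, Thm. 9.27 (b)] -/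
theorem span_le_conwayStableLattice {N : ℕ} [NeZero N] {f : CuspForm (Gamma0 N) 2}
    (hf : f ∈ integralCuspForms0 N 2)
    (heig : ∀ p : ℕ, p.Prime → p ∣ N → ∃ ε : ℂ, (ε = 1 ∨ ε = -1) ∧ atkinLehnerInvolutionAt N 2 p f = ε • f)
    (ht : ∃ ε : ℂ, (ε = 1 ∨ ε = -1) ∧ halfTranslate N 2 f = ε • f) :
    (ℤ ∙ f) ≤ conwayStableLattice N := by
  have key : ∀ (T : CuspForm (Gamma0 N) 2 →ₗ[ℂ] CuspForm (Gamma0 N) 2),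
      (∃ ε : ℂ, (ε = 1 ∨ ε = -1) ∧ T f = ε • f) → (ℤ ∙ f).map (T.restrictScalars ℤ) ≤ ℤ ∙ f := by
    intro T ⟨ε, hε, hT⟩
    rw [Submodule.map_le_iff_le_comap, Submodule.span_singleton_le_iff_mem, Submodule.mem_comap]
    show T f ∈ ℤ ∙ f
    rw [hT]
    rcases hε with rfl | rfl
    · rw [one_smul]; exact Submodule.mem_span_singleton_self f
    · rw [neg_one_smul]; exact Submodule.neg_mem _ (Submodule.mem_span_singleton_self f)
  exact le_conwayStableLattice_of_stable ((Submodule.span_singleton_le_iff_mem _ _).mpr hf)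
    (fun p hp hpN => key _ (heig p hp hpN)) (key _ ht)

/-- `ℤ∙f ≤ S^R` for an integral `±1`-eigenvector of every `w_{Q_p}` and of `R₃` (at `9 ∣ N`: `a₃ = 0 ⇒ R₃ f = −f`). (refuter-1 RB61.2, VERBATIM.) -/
theorem span_le_ramanujanStableLattice {N : ℕ} [NeZero N] {f : CuspForm (Gamma0 N) 2}
    (hf : f ∈ integralCuspForms0 N 2)
    (heig : ∀ p : ℕ, p.Prime → p ∣ N → ∃ ε : ℂ, (ε = 1 ∨ ε = -1) ∧ atkinLehnerInvolutionAt N 2 p f = ε • f)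
    (hR : ∃ ε : ℂ, (ε = 1 ∨ ε = -1) ∧ ramanujanThree N 2 f = ε • f) :
    (ℤ ∙ f) ≤ ramanujanStableLattice N := by
  have key : ∀ (T : CuspForm (Gamma0 N) 2 →ₗ[ℂ] CuspForm (Gamma0 N) 2),
      (∃ ε : ℂ, (ε = 1 ∨ ε = -1) ∧ T f = ε • f) → (ℤ ∙ f).map (T.restrictScalars ℤ) ≤ ℤ ∙ f := by
    intro T ⟨ε, hε, hT⟩
    rw [Submodule.map_le_iff_le_comap, Submodule.span_singleton_le_iff_mem, Submodule.mem_comap]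
    show T f ∈ ℤ ∙ f
    rw [hT]
    rcases hε with rfl | rfl
    · rw [one_smul]; exact Submodule.mem_span_singleton_self f
    · rw [neg_one_smul]; exact Submodule.neg_mem _ (Submodule.mem_span_singleton_self f)
  exact le_ramanujanStableLattice_of_stable ((Submodule.span_singleton_le_iff_mem _ _).mpr hf)
    (fun p hp hpN => key _ (heig p hp hpN)) (key _ hR)

/-! ### RB61.3  The GIVEN predicates have teeth: the junk datum `Λ = ⊥` (refuter-1 RB56.14, which inhabits
`NeronFLineDatum` with no Néron input) is EXCLUDED by `IsConwayNeronAtTwo` / `IsRamanujanNeronAtThree` as soon as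
the stable lattice is non-zero (e.g. contains `f ≠ 0`, RB61.2). -/

/-- The GIVEN predicate `IsConwayNeronAtTwo` has teeth: the junk datum `Λ = ⊥` (refuter-1 RB56.14) is excluded as soon as `S^G ∋ g ≠ 0`. (refuter-1 RB61.3, VERBATIM.) -/
theorem not_isConwayNeronAtTwo_of_Λ_eq_bot {N : ℕ} [NeZero N] {W : WeierstrassCurve ℚ} [W.IsElliptic]
    {D : ModularParametrizationData W N} (Δ : NeronFLineDatum W D) (hΛ : Δ.Λ = ⊥)
    {g : CuspForm (Gamma0 N) 2} (hg : g ∈ conwayStableLattice N) (hg0 : g ≠ 0) :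
    ¬ IsConwayNeronAtTwo Δ := by
  rintro ⟨-, h⟩
  obtain ⟨n, hn, hmem⟩ := h g hg
  rw [hΛ, Submodule.mem_bot, ← Int.cast_smul_eq_zsmul ℂ] at hmem
  have hn0 : ((n : ℤ) : ℂ) ≠ 0 := by exact_mod_cast hn.pos.ne'
  exact hg0 ((smul_eq_zero.mp hmem).resolve_left hn0)

/-- Twin at `3`: `Λ = ⊥` is excluded by `IsRamanujanNeronAtThree` as soon as `S^R ∋ g ≠ 0`. (refuter-1 RB61.3, VERBATIM.) -/
theorem not_isRamanujanNeronAtThree_of_Λ_eq_bot {N : ℕ} [NeZero N] {W : WeierstrassCurve ℚ} [W.IsElliptic]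
    {D : ModularParametrizationData W N} (Δ : NeronFLineDatum W D) (hΛ : Δ.Λ = ⊥)
    {g : CuspForm (Gamma0 N) 2} (hg : g ∈ ramanujanStableLattice N) (hg0 : g ≠ 0) :
    ¬ IsRamanujanNeronAtThree Δ := by
  rintro ⟨-, h⟩
  obtain ⟨n, hn, hmem⟩ := h g hg
  rw [hΛ, Submodule.mem_bot, ← Int.cast_smul_eq_zsmul ℂ] at hmem
  have hn0 : ((n : ℤ) : ℂ) ≠ 0 := by
    have : n ≠ 0 := fun h0 => hn (h0 ▸ dvd_zero 3)
    exact_mod_cast this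
  exact hg0 ((smul_eq_zero.mp hmem).resolve_left hn0)

/-! ### RB61.4  E-FACING SHADOW of the 3-adic lattice law (the only part an `E`-table can see):
E-desc-35 ⇒ «`9 ∣ N`, optimal, III*/II* at `3` ⇒ `3 ∣ deg φ`» (census 85 747/85 747 optimal + 1 833/1 833 code-2).
(The 2-adic shadows of E-desc-29/30 and RB61.5 are not landed: those rows are not filed, see `ConwayCut`.) -/

/-- E-FACING SHADOW of E-desc-35: `9 ∣ N`, optimal, III*/II* at `3` ⇒ `3 ∣ deg φ`. (refuter-1 RB61.4, VERBATIM.) -/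
theorem three_dvd_modularDegree_of_threeStarDefectLaw (hLaw : ThreeStarDefectLaw)
    (W : WeierstrassCurve ℚ) [W.IsElliptic] [W.IsGloballyMinimal] [NeZero (W.conductorNorm ℤ)]
    (D : ModularParametrizationData W (W.conductorNorm ℤ))
    (hL : ∀ z ∈ D.L.lattice, ∃ w ∈ periodLattice D.f, z = D.c * w)
    (hopt : ∀ (W' : WeierstrassCurve ℚ) [W'.IsElliptic]
        (D' : ModularParametrizationData W' (W.conductorNorm ℤ)),
        D'.f = D.f → D.modularDegree ≤ D'.modularDegree)
    (h9 : 9 ∣ W.conductorNorm ℤ) (hlarge : IsLargeStarAtThree W) :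
    3 ∣ D.modularDegree := by
  have h := hLaw W D hL hopt h9
  rw [if_pos hlarge] at h
  haveI : Fact (Nat.Prime 3) := ⟨Nat.prime_three⟩
  exact dvd_of_one_le_padicValNat (by omega)

end Summit.BirchSwinnertonDyer.Rank1Residual.ManinAdditive
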